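import Mathlib.GroupTheory.SpecificGroups.Dihedral
import Mathlib.Topology.Instances.ZMod
import Mathlib.Topology.Algebra.Group.Basic
import Literature.IUT.HodgeTheaters.GlobalFrobenioidsKummer
import HarnessLib

/-!
# [IUTchI] Remark 5.1.5, final display (pp. 133–134) — the predicate `NoSolvableFactorization`
# (FACT-LIST F-2583) in subgroup vocabulary, the printed reduction to Galois injectivity
# ([NodNon] Thm C), tightness of its two hypotheses, and an instance

S. Mochizuki, *Inter-universal Teichmüller theory I*, kurims manuscript (May 2020), Remark 5.1.5,
p. 133 l. 38 – p. 134 l. 7: "Suppose … that the outer action of the absolute Galois group of a number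
field on the geometric fundamental group of a hyperbolic curve over the number field in fact factors
through the maximal solvable quotient of the absolute Galois group. … In fact, however, the outer
action referred to above does not admit such a “solvable factorization”.  Indeed, the nonexistence
of such a “solvable factorization” is a formal consequence of the Galois injectivity result
discussed in [NodNon], Theorem C — a result that depends, in an essential way, on the theory of Belyi
maps." ([IUTchI] Rmk 5.1.5 p.133) [claim: Mochizuki2012, status: disputed]

PROOF-ONLY companion (no `def`, no `instance`, no `structure`) of abc-iut-L5-t1's
`GlobalFrobenioidsKummer.lean`, which types the display as the `Prop`-valued structure
`NoSolvableFactorization E solKer` over an extension `1 → Δ → Π → G → 1` (the tree's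
`FundamentalExtension`) and a subgroup `solKer ⊆ G` [`G^{[sol]} := Ker(G ↠ G^{sol})`]: "it is NOT the
case that every element of `Π` lying over `solKer` acts on `Δ` by an inner automorphism of `Δ`".
The frozen FACT-LIST row F-2583 is a SCHEMA (its universal closure was refuted at the identity
extension `ℤ/2 = ℤ/2` by `FactListClosureRefutations.not_noSolvableFactorization_id`); this file
records, kernel-checked and from Mathlib only:

* §1 the predicate in Mathlib's subgroup vocabulary: `g ∈ Π` acts on `Δ` by an inner automorphism of
  `Δ` iff `g ∈ Δ · C_Π(Δ)` (`actsInner_iff_mem_sup`), whence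
  `NoSolvableFactorization E solKer ↔ ¬ solKer ≤ aug(C_Π(Δ))` (`iff_not_le_map_centralizer`) and
  monotonicity in `solKer` (`mono`);
* §2 THE PRINTED REDUCTION: Galois injectivity — `C_Π(Δ) ≤ Δ`, equivalently "an element of `Π`
  acting on `Δ` by an inner automorphism of `Δ` lies in `Δ`", i.e. the outer representation
  `ρ : G → Out(Δ)` is injective ([NodNon] Thm C for hyperbolic curves over number fields; NOT a row
  of the frozen FACT-LIST, so it is kept an EXPLICIT hypothesis here, never asserted) — together with
  `solKer ≠ 1` gives `NoSolvableFactorization E solKer` (`of_centralizer_le_geom`,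
  `of_galoisInjective`, and the sharper `of_galoisInjectiveOn` using injectivity only over `solKer`);
* §3 TIGHTNESS of both hypotheses: the predicate fails at `solKer = 1` for every extension
  (`not_bot`, `solKer_ne_bot`) and fails for every `solKer` as soon as `aug(C_Π(Δ)) = G`, e.g. for
  commutative `Π` (`not_of_map_centralizer_eq_top`, `not_of_commutative` — the latter subsumes the
  `ℤ/2 = ℤ/2` refutation of the universal closure);
* §4 the INSTANCE half of the schema: at the dihedral toy `Π := D₃ ↠ G := ℤ/2` (rotations ↦ 0,
  reflections ↦ 1; `Δ = ⟨r⟩ ≅ ℤ/3`, `C_Π(Δ) = Δ`) Galois injectivity holds and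
  `NoSolvableFactorization E solKer` holds for EVERY `solKer ≠ 1`
  (`exists_galoisInjective_noSolvableFactorization`) — «record + predicate jointly satisfiable, and
  the reduction of §2 is not vacuous»; a finite toy, NOT the genuine `π₁(C_{F_mod}) ↠ G_{F_mod}`.

HONEST LABEL: nothing here proves [NodNon] Thm C or the display for the genuine extension; the row
stays consumable AT NAMED INSTANCES only.  Nothing of [IUTchI] is asserted; instantiated ≠ endorsed;
no side is taken on [IUTchIII] Cor. 3.12.
-/

namespace Literature.IUT.HodgeTheaters

namespace NoSolvableFactorization

open Literature.AnabelianGeometry.AbsoluteAnabelian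
open scoped Pointwise

universe u

variable {E : FundamentalExtension.{u}} {solKer solKer' : Subgroup E.gal}

/-! ### §1 The predicate in subgroup vocabulary -/

/-- An element `g ∈ Π` acts on `Δ` by the inner automorphism of some `d ∈ Δ` iff `g ∈ Δ · C_Π(Δ)`
(`= Δ ⊔ C_Π(Δ)`, `Δ` being normal): `g = d · (d⁻¹g)` with `d⁻¹g` centralising `Δ`.
([IUTchI] Rmk 5.1.5 p.133) [claim: Mochizuki2012, status: disputed] -/
theorem actsInner_iff_mem_sup (g : E.arith) :
    (∃ d ∈ E.geom, ∀ x ∈ E.geom, g * x * g⁻¹ = d * x * d⁻¹) ↔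
      g ∈ E.geom ⊔ Subgroup.centralizer (E.geom : Set E.arith) := by
  rw [← SetLike.mem_coe, Subgroup.normal_mul, Set.mem_mul]
  constructor
  · rintro ⟨d, hd, h⟩
    refine ⟨d, hd, d⁻¹ * g, ?_, mul_inv_cancel_left d g⟩
    rw [SetLike.mem_coe, Subgroup.mem_centralizer_iff]
    intro x hx
    calc x * (d⁻¹ * g) = d⁻¹ * (d * x * d⁻¹) * g := by group
      _ = d⁻¹ * (g * x * g⁻¹) * g := by rw [h x hx]
      _ = d⁻¹ * g * x := by group
  · rintro ⟨d, hd, c, hc, rfl⟩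
    refine ⟨d, hd, fun x hx => ?_⟩
    rw [SetLike.mem_coe, Subgroup.mem_centralizer_iff] at hc
    calc d * c * x * (d * c)⁻¹ = d * (c * x) * c⁻¹ * d⁻¹ := by group
      _ = d * (x * c) * c⁻¹ * d⁻¹ := by rw [hc x hx]
      _ = d * x * d⁻¹ := by group

/-- "The outer action admits a solvable factorization" [the negation of the display] iff
`aug⁻¹(solKer) ⊆ Δ · C_Π(Δ)`. ([IUTchI] Rmk 5.1.5 p.133) [claim: Mochizuki2012, status: disputed] -/
theorem not_iff_comap_le :
    ¬ NoSolvableFactorization E solKer ↔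
      solKer.comap E.aug.toMonoidHom ≤ E.geom ⊔ Subgroup.centralizer (E.geom : Set E.arith) := by
  rw [noSolvableFactorization_iff, not_not]
  constructor
  · intro h g hg
    exact (actsInner_iff_mem_sup g).mp (h g hg)
  · intro h g hg
    exact (actsInner_iff_mem_sup g).mpr (h hg)

/-- "The outer action admits a solvable factorization" iff `solKer ⊆ aug(C_Π(Δ))` [every class in
`solKer` has a lift centralising `Δ`]; uses the surjectivity of `aug`.
([IUTchI] Rmk 5.1.5 p.133) [claim: Mochizuki2012, status: disputed] -/
theorem not_iff_le_map_centralizer :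
    ¬ NoSolvableFactorization E solKer ↔
      solKer ≤ (Subgroup.centralizer (E.geom : Set E.arith)).map E.aug.toMonoidHom := by
  rw [not_iff_comap_le]
  constructor
  · intro h γ hγ
    obtain ⟨g, rfl⟩ := E.aug_surjective γ
    have hg : g ∈ E.geom ⊔ Subgroup.centralizer (E.geom : Set E.arith) := h hγ
    rw [← SetLike.mem_coe, Subgroup.normal_mul, Set.mem_mul] at hg
    obtain ⟨d, hd, c, hc, rfl⟩ := hg
    rw [SetLike.mem_coe, FundamentalExtension.mem_geom] at hd
    refine ⟨c, hc, ?_⟩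
    change E.aug c = E.aug (d * c)
    rw [map_mul, hd, one_mul]
  · intro h g hg
    obtain ⟨c, hc, hcg⟩ := h hg
    change E.aug c = E.aug g at hcg
    rw [← SetLike.mem_coe, Subgroup.normal_mul, Set.mem_mul]
    refine ⟨g * c⁻¹, ?_, c, hc, inv_mul_cancel_right g c⟩
    rw [SetLike.mem_coe, FundamentalExtension.mem_geom, map_mul, map_inv, ← hcg, mul_inv_cancel]

/-- **The display in subgroup vocabulary**: `NoSolvableFactorization E solKer ↔ ¬ solKer ⊆ aug(C_Π(Δ))`.
([IUTchI] Rmk 5.1.5 p.133) [claim: Mochizuki2012, status: disputed] -/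
theorem iff_not_le_map_centralizer :
    NoSolvableFactorization E solKer ↔
      ¬ solKer ≤ (Subgroup.centralizer (E.geom : Set E.arith)).map E.aug.toMonoidHom := by
  rw [← not_iff_le_map_centralizer, not_not]

/-- Equivalently: some class `γ ∈ solKer` has NO lift to `Π` centralising `Δ`.
([IUTchI] Rmk 5.1.5 p.133) [claim: Mochizuki2012, status: disputed] -/
theorem iff_exists_not_mem_map_centralizer :
    NoSolvableFactorization E solKer ↔
      ∃ γ ∈ solKer, γ ∉ (Subgroup.centralizer (E.geom : Set E.arith)).map E.aug.toMonoidHom := by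
  rw [iff_not_le_map_centralizer, SetLike.not_le_iff_exists]

/-- The display is MONOTONE in `solKer`: if the outer action does not factor through `G/solKer`, it
does not factor through any smaller quotient `G/solKer'`, `solKer ⊆ solKer'`.
([IUTchI] Rmk 5.1.5 p.133) [claim: Mochizuki2012, status: disputed] -/
theorem mono (hle : solKer ≤ solKer') (h : NoSolvableFactorization E solKer) :
    NoSolvableFactorization E solKer' := by
  rw [iff_not_le_map_centralizer] at h ⊢
  exact fun h' => h (hle.trans h')

/-! ### §2 The printed reduction: Galois injectivity ⇒ no solvable factorization -/

/-- Galois injectivity in the two phrasings used below: `C_Π(Δ) ⊆ Δ` iff "every element of `Π` acting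
on `Δ` by an inner automorphism of `Δ` lies in `Δ`" [i.e. the outer representation `G → Out(Δ)` is
injective]. ([IUTchI] Rmk 5.1.5 p.133) [claim: Mochizuki2012, status: disputed] -/
theorem centralizer_le_geom_iff :
    Subgroup.centralizer (E.geom : Set E.arith) ≤ E.geom ↔
      ∀ g : E.arith, (∃ d ∈ E.geom, ∀ x ∈ E.geom, g * x * g⁻¹ = d * x * d⁻¹) → g ∈ E.geom := by
  constructor
  · intro h g hg
    exact (sup_le le_rfl h) ((actsInner_iff_mem_sup g).mp hg)
  · intro h c hc
    exact h c ((actsInner_iff_mem_sup c).mpr (Subgroup.mem_sup_right hc))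

/-- **Remark 5.1.5 via Galois injectivity** ("a formal consequence of the Galois injectivity result
discussed in [NodNon], Theorem C"): if `C_Π(Δ) ⊆ Δ` [the outer representation `G → Out(Δ)` is
injective — an EXPLICIT hypothesis, not a FACT-LIST row] and `solKer ≠ 1`, then the outer action does
not admit a solvable factorization through `G/solKer`.  [Proof: a factorization gives
`solKer ⊆ aug(C_Π(Δ)) ⊆ aug(Δ) = 1`.] ([IUTchI] Rmk 5.1.5 p.133) [claim: Mochizuki2012, status: disputed] -/
theorem of_centralizer_le_geom (hinj : Subgroup.centralizer (E.geom : Set E.arith) ≤ E.geom)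
    (hsol : solKer ≠ ⊥) : NoSolvableFactorization E solKer := by
  rw [iff_not_le_map_centralizer]
  intro hle
  apply hsol
  rw [eq_bot_iff]
  refine hle.trans ?_
  rw [Subgroup.map_le_iff_le_comap, MonoidHom.comap_bot]
  exact hinj

/-- **Remark 5.1.5 via Galois injectivity**, element phrasing: if every element of `Π` acting on `Δ`
by an inner automorphism of `Δ` lies in `Δ` [injectivity of `G → Out(Δ)`, explicit hypothesis] and
`solKer ≠ 1`, then `NoSolvableFactorization E solKer`.
([IUTchI] Rmk 5.1.5 p.133) [claim: Mochizuki2012, status: disputed] -/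
theorem of_galoisInjective
    (hinj : ∀ g : E.arith, (∃ d ∈ E.geom, ∀ x ∈ E.geom, g * x * g⁻¹ = d * x * d⁻¹) → g ∈ E.geom)
    (hsol : solKer ≠ ⊥) : NoSolvableFactorization E solKer :=
  of_centralizer_le_geom (centralizer_le_geom_iff.mpr hinj) hsol

/-- **Remark 5.1.5 via Galois injectivity**, sharpest form: it suffices that the outer representation
be injective ON `solKer` [no non-trivial class of `solKer` acts outer-trivially on `Δ`] and that
`solKer ≠ 1`. ([IUTchI] Rmk 5.1.5 p.133) [claim: Mochizuki2012, status: disputed] -/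
theorem of_galoisInjectiveOn
    (hinj : ∀ g : E.arith, E.aug g ∈ solKer →
      (∃ d ∈ E.geom, ∀ x ∈ E.geom, g * x * g⁻¹ = d * x * d⁻¹) → E.aug g = 1)
    (hsol : solKer ≠ ⊥) : NoSolvableFactorization E solKer := by
  rw [noSolvableFactorization_iff]
  intro hall
  apply hsol
  rw [Subgroup.eq_bot_iff_forall]
  intro γ hγ
  obtain ⟨g, rfl⟩ := E.aug_surjective γ
  exact hinj g hγ (hall g hγ)

/-- Conversely the display FORCES a non-trivial class of `solKer` acting outer-non-trivially: from
`NoSolvableFactorization E solKer`, some `g ∈ Π` over `solKer`, with `aug g ≠ 1`, acts on `Δ` by no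
inner automorphism of `Δ`. ([IUTchI] Rmk 5.1.5 p.133) [claim: Mochizuki2012, status: disputed] -/
theorem exists_not_actsInner (h : NoSolvableFactorization E solKer) :
    ∃ g : E.arith, E.aug g ∈ solKer ∧ E.aug g ≠ 1 ∧
      ¬ ∃ d ∈ E.geom, ∀ x ∈ E.geom, g * x * g⁻¹ = d * x * d⁻¹ := by
  obtain ⟨h⟩ := h
  by_contra hc
  apply h
  intro g hg
  by_contra hin
  apply hc
  refine ⟨g, hg, ?_, hin⟩
  intro h1
  exact hin ⟨g, (FundamentalExtension.mem_geom E).mpr h1, fun x _ => rfl⟩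

/-! ### §3 Tightness of the two hypotheses -/

/-- TIGHTNESS of `solKer ≠ 1`: over the trivial subgroup the outer action always "factors" [elements of
`Π` over `1` lie in `Δ` and act on `Δ` by themselves], for EVERY extension.
([IUTchI] Rmk 5.1.5 p.133) [claim: Mochizuki2012, status: disputed] -/
theorem not_bot : ¬ NoSolvableFactorization E (⊥ : Subgroup E.gal) := by
  rw [not_iff_le_map_centralizer]
  exact bot_le

/-- Hence the display entails `solKer ≠ 1` [for `G_{F_mod}`: the absolute Galois group of a number
field is not pro-solvable]. ([IUTchI] Rmk 5.1.5 p.133) [claim: Mochizuki2012, status: disputed] -/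
theorem solKer_ne_bot (h : NoSolvableFactorization E solKer) : solKer ≠ ⊥ := by
  rintro rfl
  exact not_bot h

/-- TIGHTNESS of Galois injectivity: if the centraliser `C_Π(Δ)` surjects onto `G` [e.g. `Π = Δ × G`,
or `Π` commutative, or `Δ = 1`], the outer action is trivial and factors through EVERY quotient — the
display fails for every `solKer`. ([IUTchI] Rmk 5.1.5 p.133) [claim: Mochizuki2012, status: disputed] -/
theorem not_of_map_centralizer_eq_top
    (h : (Subgroup.centralizer (E.geom : Set E.arith)).map E.aug.toMonoidHom = ⊤) :
    ¬ NoSolvableFactorization E solKer := by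
  rw [not_iff_le_map_centralizer, h]
  exact le_top

/-- In particular the display fails for every `solKer` whenever `Π` is commutative (this subsumes the
refutation of the universal closure of F-2583 at the identity extension `ℤ/2 = ℤ/2`,
`FactListClosureRefutations.not_noSolvableFactorization_id`): SCHEMA evidence about the typing, not
about print. ([IUTchI] Rmk 5.1.5 p.133) [claim: Mochizuki2012, status: disputed] -/
theorem not_of_commutative (hcomm : ∀ a b : E.arith, a * b = b * a) :
    ¬ NoSolvableFactorization E solKer := by
  apply not_of_map_centralizer_eq_top
  have hc : Subgroup.centralizer (E.geom : Set E.arith) = ⊤ := by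
    rw [eq_top_iff]
    intro g _
    rw [Subgroup.mem_centralizer_iff]
    exact fun x _ => hcomm x g
  rw [hc, ← MonoidHom.range_eq_map, MonoidHom.range_eq_top]
  exact E.aug_surjective

/-! ### §4 The instance half of the schema: the dihedral toy `D₃ ↠ ℤ/2` -/

/-- **F-2583, instance half** (`_toy`, flagged: a finite toy, NOT the genuine `π₁(C_{F_mod}) ↠ G_{F_mod}`):
there is an extension — `Π := D₃` (dihedral of order `6`) `↠ G := ℤ/2`, rotations `↦ 0`, reflections
`↦ 1`, so `Δ = ⟨r⟩ ≅ ℤ/3` and `C_Π(Δ) = Δ` — satisfying Galois injectivity, at which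
`NoSolvableFactorization E solKer` holds for EVERY `solKer ≠ 1` [a reflection inverts `r`, which no
rotation does]; so the record and the predicate are jointly satisfiable and the reduction
`of_centralizer_le_geom` is not vacuous. ([IUTchI] Rmk 5.1.5 p.133) [claim: Mochizuki2012, status: disputed] -/
theorem exists_galoisInjective_noSolvableFactorization :
    ∃ E : FundamentalExtension.{0},
      Subgroup.centralizer (E.geom : Set E.arith) ≤ E.geom ∧
      (⊥ : Subgroup E.gal) ≠ ⊤ ∧
      ∀ solKer : Subgroup E.gal, solKer ≠ ⊥ → NoSolvableFactorization E solKer := by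
  letI : TopologicalSpace (DihedralGroup 3) := ⊥
  haveI : DiscreteTopology (DihedralGroup 3) := ⟨rfl⟩
  -- the parity character `D₃ → ℤ/2`
  let f : DihedralGroup 3 →* Multiplicative (ZMod 2) :=
    { toFun := fun g => match g with
        | DihedralGroup.r _ => 1
        | DihedralGroup.sr _ => Multiplicative.ofAdd 1
      map_one' := rfl
      map_mul' := by
        rintro (a | a) (b | b)
        · rfl
        · rfl
        · rfl
        · show (1 : Multiplicative (ZMod 2)) = Multiplicative.ofAdd 1 * Multiplicative.ofAdd 1
          decide }
  let aug : ContinuousMonoidHom (DihedralGroup 3) (Multiplicative (ZMod 2)) :=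
    { f with continuous_toFun := continuous_of_discreteTopology }
  have hsurj : Function.Surjective aug := by
    intro y
    obtain ⟨k, rfl⟩ := Multiplicative.ofAdd.surjective y
    fin_cases k
    · exact ⟨DihedralGroup.r 0, rfl⟩
    · exact ⟨DihedralGroup.sr 0, rfl⟩
  let E : FundamentalExtension.{0} :=
    ⟨ProfiniteGrp.of (DihedralGroup 3), ProfiniteGrp.of (Multiplicative (ZMod 2)), aug, hsurj⟩
  -- rotations lie in `Δ = Ker(aug)`
  have hr : ∀ i : ZMod 3, (DihedralGroup.r i : E.arith) ∈ E.geom := fun i => rfl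
  have hinj : Subgroup.centralizer (E.geom : Set E.arith) ≤ E.geom := by
    intro g hg
    rw [Subgroup.mem_centralizer_iff] at hg
    obtain (i | i) := g
    · exact hr i
    · exfalso
      have key := hg (DihedralGroup.r 1) (hr 1)
      change DihedralGroup.r 1 * DihedralGroup.sr i = DihedralGroup.sr i * DihedralGroup.r 1 at key
      rw [DihedralGroup.r_mul_sr, DihedralGroup.sr_mul_r] at key
      have hne : ∀ j : ZMod 3, (DihedralGroup.sr (j - 1) : DihedralGroup 3) ≠ DihedralGroup.sr (j + 1) := by
        decide
      exact hne i key
  refine ⟨E, hinj, ?_, fun solKer hsol => of_centralizer_le_geom hinj hsol⟩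
  change (⊥ : Subgroup (Multiplicative (ZMod 2))) ≠ ⊤
  exact bot_ne_top

/-- Hence `NoSolvableFactorization E ⊤` is inhabited at some extension [the schema F-2583 is jointly
satisfiable; with `FactListClosureRefutations.not_noSolvableFactorization_id` it is a SCHEMA consumable
at named instances only]. ([IUTchI] Rmk 5.1.5 p.133) [claim: Mochizuki2012, status: disputed] -/
theorem exists_noSolvableFactorization_top :
    ∃ E : FundamentalExtension.{0}, NoSolvableFactorization E ⊤ := by
  obtain ⟨E, -, hbt, h⟩ := exists_galoisInjective_noSolvableFactorization
  exact ⟨E, h ⊤ (Ne.symm hbt)⟩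

end NoSolvableFactorization

end Literature.IUT.HodgeTheaters
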